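/-
Copyright: cell pub-balaban-gaps (YM BLITZ Y1, track G1), seat g1-p2 GEN 5 (unit `pub-balaban-gaps-g1-p2`).  Row (D4) NODE O,
OBJECT ∕ MECHANISM level: the TUBE LETTER of `D4WalkBlockDecorate` for the chains of the parametrix ([B9] (3.90)–(3.94): walks
ω = (□₀, □₁, …, □ₙ) of domain-localised steps) — [II] (1.11) p. 5 *"m is the number of the parameters s connected with the walk ω.
If m is big enough … then δ₀d(ω) ≥ δ₁mM"* AS A LEMMA on the cube torus: the distinct parameters met by the domains of a chain number
`≤ P·(1 + D_ω(y,y′)∕r)`, `D_ω` the chain's walk distance (a greedy `r`-net along the via-points of the steps + packing; the prior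
programme's `Beta/UnitLatticeTubeCount` argument of unit `b2b-balaban-beta-d4-p3`, re-done on LISTS for the chain terms of
`D4WalkBlockNeumann.blockWalkExpansion_inv_pencil`).
HONEST FRAMING: lattice geometry over hypothesis letters (packing `P` at radius `R`, domain diameter `D`, parameters of a term =
cells of its domain's cubes); nothing of Bałaban's constructed; (D4) NOT discharged (instance 0∕1); NOT continuum, NOT Clay.
-/
import Summits.QuantumFields.BalabanUV.Gaps.D4WalkBlockDecorate
import Summits.QuantumFields.BalabanUV.Gaps.D4WalkBlockLocal

/-!
# `Gaps.D4WalkBlockDecorateChains` — the tube letter `#dec(ω) ≤ P(1 + D_ω∕r)` for chains of domain-localised steps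
(cell pub-balaban-gaps, seat g1-p2 gen 5)

HONEST DEPENDENCY (cell pub-balaban, verbatim): continuum YM on T⁴ ⇐ BetaPertH ∧ nine spine estimates (0/9 proved);
BetaPertH ⇐ (D1) ∧ (D4) ∧ CAP+tail.

* §1 (generic symmetric pseudo-metric) `lpathLen` of a point list; `exists_anchors_list` (greedy `r`-net: every point within `r` of an
  anchor, `(#A − 1)·r ≤` path length); `card_le_of_pointList` (cells within `D` of the points number `≤ P·(1 + ℓ∕r)` under packing
  `P` at radius `R ≥ r + D`).
* §2 (domain skeleton `L` on the cube torus) the chain distance `Dch b₀ l` of a seed term `b₀` followed by steps `l` (the distance of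
  the term `(b₀, (l, ()))` of `blockWalkExpansion_mul ∘ blockWalkExpansion_inv_pencil ∘ blockWalkExpansion_one` over one-point
  distances); `exists_viaList`: a list of points, one in each visited domain, of path length `≤ Dch b₀ l (y,y′)`.
* §3 `card_params_le`: with parameters attached to domains (`J′ b ⊆ (dom b).image cellOf`), domain diameter `≤ D`, packing `P` at
  radius `R ≥ r + D`: any `T ⊆ J′ b₀ ∪ ⋃_{i ∈ l} J′ i.2` has `#T ≤ P·(1 + Dch b₀ l (y,y′)∕r)` — the tube letter `htube` of
  `D4WalkBlockDecorate.blockWalkExpansion_decorate` with `P₀ = P`, `P₁ = P∕r` for these chains.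
WHAT IT IS NOT: the decorated parametrix itself is assembled by the consumer (explicit composition `mul ∘ inv_pencil ∘ one` of the
cell's block files, then `blockWalkExpansion_decorate`); nothing of Bałaban's; (D4) instance 0∕1; words UNCHANGED.
-/

noncomputable section

namespace Summit.QuantumFields.BalabanUV.Gaps.D4WalkBlockDecorateChains

open Metric Set Finset
open Literature.MathematicalPhysics.QuantumFieldTheory.Balaban1983to89
open Literature.MathematicalPhysics.QuantumFieldTheory.Balaban1983to89.B9SectDWalk (infConv chainDist infConv_le exists_infConv_eq)
open Literature.MathematicalPhysics.QuantumFieldTheory.Balaban1983to89.B9Thm34Ext (toB6)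
open Literature.MathematicalPhysics.QuantumFieldTheory.Balaban1983to89.B9Thm37GlueTorus
  (torusGeom tdist1 tdist1_nonneg tdist1_self tdist1_comm tdist1_triangle)
open Literature.MathematicalPhysics.QuantumFieldTheory.Balaban1983to89.TreeLengthTorus (TPt)
open Literature.MathematicalPhysics.QuantumFieldTheory.Balaban1983to89.B5TorusCover (UT)
open Literature.MathematicalPhysics.QuantumFieldTheory.Balaban1983to89.B13DomainKernelWalks (DomainTerms)

/-! ## §1. A greedy `r`-net along a list of points; the tube count -/

section Net

variable {Y : Type*} (d : Y → Y → ℝ)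

/-- The length of a point list `v₀, v₁, …`: `Σ d(v_t, v_{t+1})`. [folklore] -/
def lpathLen : List Y → ℝ
  | [] => 0
  | [_] => 0
  | v :: w :: rest => d v w + lpathLen (w :: rest)

/-- Unfolding at two leading points. [folklore] -/
@[simp] theorem lpathLen_cons_cons (v w : Y) (rest : List Y) :
    lpathLen d (v :: w :: rest) = d v w + lpathLen d (w :: rest) := rfl

/-- A one-point list has length `0`. [folklore] -/
@[simp] theorem lpathLen_single (v : Y) : lpathLen d [v] = 0 := rfl

/-- Path lengths are non-negative for a non-negative `d`. [folklore] -/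
theorem lpathLen_nonneg (hnn : ∀ a b, 0 ≤ d a b) : ∀ l : List Y, 0 ≤ lpathLen d l
  | [] => le_rfl
  | [_] => le_rfl
  | v :: w :: rest => add_nonneg (hnn v w) (lpathLen_nonneg hnn (w :: rest))

/-- Prepending a point adds the first link. [folklore] -/
theorem lpathLen_cons_le (hnn : ∀ a b, 0 ≤ d a b) (v : Y) : ∀ l : List Y, lpathLen d l ≤ lpathLen d (v :: l)
  | [] => le_rfl
  | w :: rest => by rw [lpathLen_cons_cons]; exact le_add_of_nonneg_left (hnn v w)

/-- **ANCHORS** (greedy `r`-net from the right end; `d` a pseudo-metric with `d(a,a) = 0` and the triangle inequality): every point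
of a non-empty list is within `r` of an anchor, and `(#A − 1)·r + d(head, a) ≤` the list's length for a distinguished anchor `a`.
[folklore] -/
theorem exists_anchors_list [DecidableEq Y] (htri : ∀ a b c, d a c ≤ d a b + d b c) (hzero : ∀ a, d a a = 0) {r : ℝ} (hr : 0 ≤ r) :
    ∀ (v : Y) (l : List Y), ∃ (A : Finset Y) (a : Y), a ∈ A ∧ (∀ w ∈ v :: l, ∃ s ∈ A, d w s ≤ r) ∧
      ((A.card : ℝ) - 1) * r + d v a ≤ lpathLen d (v :: l)
  | v, [] => ⟨{v}, v, Finset.mem_singleton_self v, fun w hw => ⟨v, Finset.mem_singleton_self v, by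
      rw [List.mem_singleton.1 hw, hzero]; exact hr⟩, by simp [hzero]⟩
  | v, w :: rest => by
      obtain ⟨A, a, ha, hcov, hlen⟩ := exists_anchors_list htri hzero hr w rest
      by_cases hva : d v a ≤ r
      · refine ⟨A, a, ha, fun x hx => ?_, ?_⟩
        · rcases List.mem_cons.1 hx with rfl | hx'
          · exact ⟨a, ha, hva⟩
          · exact hcov x hx'
        · rw [lpathLen_cons_cons]
          linarith [htri v w a]
      · push Not at hva
        refine ⟨insert v A, v, Finset.mem_insert_self v A, fun x hx => ?_, ?_⟩
        · rcases List.mem_cons.1 hx with rfl | hx'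
          · exact ⟨x, Finset.mem_insert_self x A, by rw [hzero]; exact hr⟩
          · obtain ⟨s, hs, hxs⟩ := hcov x hx'
            exact ⟨s, Finset.mem_insert_of_mem hs, hxs⟩
        · rw [lpathLen_cons_cons, hzero, add_zero]
          have hcard : ((insert v A).card : ℝ) ≤ A.card + 1 := by exact_mod_cast Finset.card_insert_le v A
          have h1 : (((insert v A).card : ℝ) - 1) * r ≤ ((A.card : ℝ) - 1) * r + r := by nlinarith
          linarith [htri v w a]

/-- **TUBE COUNT for a point list**: cells within `D` of the points of a non-empty list of length `ℓ` number `≤ P·(1 + ℓ∕r)` when every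
`R`-ball meets `≤ P` cells and `r + D ≤ R` (`d` symmetric). [folklore] -/
theorem card_le_of_pointList [DecidableEq Y] (htri : ∀ a b c, d a c ≤ d a b + d b c) (hzero : ∀ a, d a a = 0) (hsymm : ∀ a b, d a b = d b a)
    (hnn : ∀ a b, 0 ≤ d a b) {r D R : ℝ} (hr : 0 < r) (hRD : r + D ≤ R) {Δ : Type*} [DecidableEq Δ] (cellOf : Y → Δ) {P : ℕ}
    (hpack : ∀ a : Y, ∃ S : Finset Δ, S.card ≤ P ∧ ∀ z, d a z ≤ R → cellOf z ∈ S)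
    (v : Y) (l : List Y) (T : Finset Δ) (hT : ∀ δ ∈ T, ∃ w ∈ v :: l, ∃ z, d w z ≤ D ∧ cellOf z = δ) :
    (T.card : ℝ) ≤ P * (1 + lpathLen d (v :: l) / r) := by
  obtain ⟨A, a, _, hcov, hlen⟩ := exists_anchors_list d htri hzero hr.le v l
  choose S hS using hpack
  have hsub : T ⊆ A.biUnion fun s => S s := by
    intro δ hδ
    obtain ⟨w, hw, z, hwz, hzc⟩ := hT δ hδ
    obtain ⟨s, hs, hws⟩ := hcov w hw
    refine Finset.mem_biUnion.2 ⟨s, hs, ?_⟩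
    rw [← hzc]
    refine (hS s).2 z ?_
    calc d s z ≤ d s w + d w z := htri _ _ _
      _ ≤ r + D := add_le_add (by rw [hsymm]; exact hws) hwz
      _ ≤ R := hRD
  have hcardA : (A.card : ℝ) ≤ 1 + lpathLen d (v :: l) / r := by
    have h1 : ((A.card : ℝ) - 1) * r ≤ lpathLen d (v :: l) := by linarith [hnn v a]
    have h2 : (A.card : ℝ) - 1 ≤ lpathLen d (v :: l) / r := by rwa [le_div_iff₀ hr]
    linarith
  calc (T.card : ℝ) ≤ ((A.biUnion fun s => S s).card : ℝ) := by exact_mod_cast Finset.card_le_card hsub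
    _ ≤ ((∑ s ∈ A, (S s).card : ℕ) : ℝ) := by exact_mod_cast Finset.card_biUnion_le
    _ = ∑ s ∈ A, ((S s).card : ℝ) := by push_cast; rfl
    _ ≤ ∑ _s ∈ A, (P : ℝ) := Finset.sum_le_sum fun s _ => by exact_mod_cast (hS s).1
    _ = A.card * P := by rw [Finset.sum_const, nsmul_eq_mul]
    _ ≤ (1 + lpathLen d (v :: l) / r) * P := mul_le_mul_of_nonneg_right hcardA (Nat.cast_nonneg P)
    _ = P * (1 + lpathLen d (v :: l) / r) := mul_comm _ _

end Net

/-! ## §2. Via-point lists along the chains of the parametrix -/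

section Chains

variable {d₀ N' : ℕ} {ν : ℕ} {K : Fin ν → ℕ} [∀ i, NeZero (K i)]
variable {n : Type} {E : Type*} [NormedAddCommGroup E] [NormedSpace ℂ E]
variable (L : DomainTerms d₀ N' ν K n n E) (X : Finset (UT K))

/-- The CHAIN DISTANCE of the glued parametrix term `(b₀, l)`: seed one-point distance, then the steps' one-point distances glued
through the identity's `d₁` (the distance of the term `(b₀, (l, ()))` of `mul ∘ inv_pencil ∘ one`). [cite: Balaban1985BackgroundPropagators, (3.93) p.410] -/
def Dch (b₀ : L.B) (l : List (Unit × L.B)) : UT K → UT K → ℝ :=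
  infConv (g := toB6 (torusGeom K 0 0 0) 0 True) (L.dist X b₀)
    (chainDist (g := toB6 (torusGeom K 0 0 0) 0 True)
      (fun i : Unit × L.B => infConv (g := toB6 (torusGeom K 0 0 0) 0 True) (tdist1 K) (L.dist X i.2)) (tdist1 K) l)

variable {L X}

/-- One-point distances satisfy the LEFT triangle inequality `D_b(y,y′) ≤ d₁(y,z) + D_b(z,y′)`. [cite: Balaban1985BackgroundPropagators, (3.93) p.410] -/
theorem dist_le_tdist1_add (hdom : ∀ b, (L.dom b).Nonempty) (b : L.B) (y z y' : UT K) :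
    L.dist X b y y' ≤ tdist1 K y z + L.dist X b z y' := by
  obtain ⟨v, hv, e⟩ := L.exists_dist_eq X b (L.via_nonempty X (hdom b)) z y'
  rw [e]
  have h1 := L.dist_le X b hv y y'
  have h2 := tdist1_triangle (N := K) y z v
  linarith

/-- One-point distances satisfy the RIGHT triangle inequality `D_b(y,y′) ≤ D_b(y,z) + d₁(z,y′)`. [cite: Balaban1985BackgroundPropagators, (3.93) p.410] -/
theorem dist_le_add_tdist1 (hdom : ∀ b, (L.dom b).Nonempty) (b : L.B) (y z y' : UT K) :
    L.dist X b y y' ≤ L.dist X b y z + tdist1 K z y' := by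
  obtain ⟨v, hv, e⟩ := L.exists_dist_eq X b (L.via_nonempty X (hdom b)) y z
  rw [e]
  have h1 := L.dist_le X b hv y y'
  have h2 := tdist1_triangle (N := K) v z y'
  linarith

/-- `infConv d₁ D_b ≥ D_b` (left triangle inequality). [cite: Balaban1985BackgroundPropagators, (3.93) p.410] -/
theorem dist_le_infConv_tdist1 (hdom : ∀ b, (L.dom b).Nonempty) (b : L.B) (y y' : UT K) :
    L.dist X b y y' ≤ infConv (g := toB6 (torusGeom K 0 0 0) 0 True) (tdist1 K) (L.dist X b) y y' := by
  obtain ⟨z, hz⟩ := exists_infConv_eq (g := toB6 (torusGeom K 0 0 0) 0 True) (tdist1 K) (L.dist X b) y y'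
  rw [hz]
  exact dist_le_tdist1_add hdom b y z y'

/-- **VIA-POINT LIST of a chain**: for the seed `b₀` and steps `l` there are points `v₀ ∈ dom b₀`, `v_k ∈ dom (l_k)` — one in EVERY
visited domain — with `d₁(y, v₀) + lpathLen(v₀, v₁, …) ≤ Dch b₀ l (y, y′)` (each one-point distance is attained at a via point inside
the domain; junction points are dropped by the triangle inequality). [cite: Balaban1985BackgroundPropagators, (3.93) p.410; Balaban1988RG2Cluster, (1.11) p.5] -/
theorem exists_viaList (hdom : ∀ b, (L.dom b).Nonempty) :
    ∀ (l : List (Unit × L.B)) (b₀ : L.B) (y y' : UT K), ∃ (v₀ : UT K) (vs : List (UT K)),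
      v₀ ∈ L.dom b₀ ∧ (∀ i ∈ l, ∃ v ∈ v₀ :: vs, v ∈ L.dom i.2) ∧
        tdist1 K y v₀ + lpathLen (tdist1 K) (v₀ :: vs) ≤ Dch L X b₀ l y y'
  | [], b₀, y, y' => by
      obtain ⟨z, hz⟩ := exists_infConv_eq (g := toB6 (torusGeom K 0 0 0) 0 True) (L.dist X b₀) (tdist1 K) y y'
      obtain ⟨v, hv, e⟩ := L.exists_dist_eq X b₀ (L.via_nonempty X (hdom b₀)) y z
      refine ⟨v, [], L.via_subset X b₀ hv, fun i hi => by simp at hi, ?_⟩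
      rw [Dch, chainDist, hz, e, lpathLen_single, add_zero]
      linarith [tdist1_nonneg v z, tdist1_nonneg z y']
  | i :: l, b₀, y, y' => by
      -- Dch b₀ (i :: l) (y,y′) = D_{b₀}(y,z) + [infConv d₁ D_{i}] ∘ chainDist l (z,y′) ≥ D_{b₀}(y,z) + Dch i.2 l (z,y′)
      obtain ⟨z, hz⟩ := exists_infConv_eq (g := toB6 (torusGeom K 0 0 0) 0 True) (L.dist X b₀)
        (chainDist (g := toB6 (torusGeom K 0 0 0) 0 True)
          (fun i : Unit × L.B => infConv (g := toB6 (torusGeom K 0 0 0) 0 True) (tdist1 K) (L.dist X i.2)) (tdist1 K) (i :: l))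
        y y'
      obtain ⟨z₁, hz₁⟩ := exists_infConv_eq (g := toB6 (torusGeom K 0 0 0) 0 True)
        (infConv (g := toB6 (torusGeom K 0 0 0) 0 True) (tdist1 K) (L.dist X i.2))
        (chainDist (g := toB6 (torusGeom K 0 0 0) 0 True)
          (fun i : Unit × L.B => infConv (g := toB6 (torusGeom K 0 0 0) 0 True) (tdist1 K) (L.dist X i.2)) (tdist1 K) l) z y'
      obtain ⟨v₀, hv₀, e₀⟩ := L.exists_dist_eq X b₀ (L.via_nonempty X (hdom b₀)) y z
      -- the tail: Dch i.2 l (z, y′) ≤ infConv d₁ D_i (z,z₁) + chainDist l (z₁,y′)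
      have htail : Dch L X i.2 l z y' ≤
          infConv (g := toB6 (torusGeom K 0 0 0) 0 True) (tdist1 K) (L.dist X i.2) z z₁ +
            chainDist (g := toB6 (torusGeom K 0 0 0) 0 True)
              (fun i : Unit × L.B => infConv (g := toB6 (torusGeom K 0 0 0) 0 True) (tdist1 K) (L.dist X i.2)) (tdist1 K) l
              z₁ y' :=
        (infConv_le (g := toB6 (torusGeom K 0 0 0) 0 True) _ _ z y' z₁).trans
          (add_le_add (dist_le_infConv_tdist1 hdom i.2 z z₁) le_rfl)
      obtain ⟨w₀, ws, hw₀, hcov, hlen⟩ := exists_viaList hdom l i.2 z y'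
      refine ⟨v₀, w₀ :: ws, L.via_subset X b₀ hv₀, fun i' hi' => ?_, ?_⟩
      · rcases List.mem_cons.1 hi' with rfl | hi''
        · exact ⟨w₀, List.mem_cons_of_mem _ (List.mem_cons_self), hw₀⟩
        · obtain ⟨v, hv, hvd⟩ := hcov i' hi''
          exact ⟨v, List.mem_cons_of_mem _ hv, hvd⟩
      · rw [lpathLen_cons_cons, Dch, hz, e₀]
        rw [chainDist, hz₁]
        have h1 := tdist1_triangle (N := K) v₀ z w₀
        linarith [htail, hlen]

end Chains

/-! ## §3. The tube letter for the chains -/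

section Tube

variable {d₀ N' : ℕ} {ν : ℕ} {K : Fin ν → ℕ} [∀ i, NeZero (K i)]
variable {n : Type} {E : Type*} [NormedAddCommGroup E] [NormedSpace ℂ E]
variable {L : DomainTerms d₀ N' ν K n n E} {X : Finset (UT K)}

/-- **THE TUBE LETTER** ([II] (1.11): *"δ₀d(ω) ≥ δ₁mM"*): parameters attached to domains (`J′ b ⊆ (dom b).image cellOf`), domains
non-empty of diameter `≤ D`, every `R`-ball of cubes meeting `≤ P` cells, `0 < r`, `r + D ≤ R` ⟹ the distinct parameters of the chain
`(b₀, l)` number `≤ P·(1 + Dch b₀ l (y,y′)∕r)` for EVERY pair `(y, y′)`. [cite: Balaban1988RG2Cluster, (1.11) p.5, p.3] -/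
theorem card_params_le (hdom : ∀ b, (L.dom b).Nonempty) {D r R : ℝ} (hr : 0 < r) (hRD : r + D ≤ R)
    (hdiam : ∀ b, ∀ z ∈ L.dom b, ∀ z' ∈ L.dom b, tdist1 K z z' ≤ D)
    (cellOf : UT K → TPt d₀ N') {P : ℕ}
    (hpack : ∀ a : UT K, ∃ S : Finset (TPt d₀ N'), S.card ≤ P ∧ ∀ z, tdist1 K a z ≤ R → cellOf z ∈ S)
    (J' : L.B → Finset (TPt d₀ N')) (hJ' : ∀ b, J' b ⊆ (L.dom b).image cellOf)
    (b₀ : L.B) (l : List (Unit × L.B)) (y y' : UT K) (T : Finset (TPt d₀ N'))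
    (hT : ∀ δ ∈ T, δ ∈ J' b₀ ∨ ∃ i ∈ l, δ ∈ J' i.2) :
    (T.card : ℝ) ≤ P * (1 + Dch L X b₀ l y y' / r) := by
  obtain ⟨v₀, vs, hv₀, hcov, hlen⟩ := exists_viaList hdom l b₀ y y'
  have hP : (0 : ℝ) ≤ P := Nat.cast_nonneg P
  have hpath : lpathLen (tdist1 K) (v₀ :: vs) ≤ Dch L X b₀ l y y' := by linarith [tdist1_nonneg y v₀]
  refine (card_le_of_pointList (tdist1 K) (fun a b c => tdist1_triangle a b c) tdist1_self tdist1_comm tdist1_nonneg hr hRD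
    cellOf hpack v₀ vs T fun δ hδ => ?_).trans (mul_le_mul_of_nonneg_left (by gcongr) hP)
  -- every parameter of the chain is the cell of a cube of a visited domain, within `D` of that domain's via point
  rcases hT δ hδ with h0 | ⟨i, hi, hδi⟩
  · obtain ⟨z, hz, hzc⟩ := Finset.mem_image.1 (hJ' b₀ h0)
    exact ⟨v₀, List.mem_cons_self, z, hdiam b₀ v₀ hv₀ z hz, hzc⟩
  · obtain ⟨z, hz, hzc⟩ := Finset.mem_image.1 (hJ' i.2 hδi)
    obtain ⟨v, hv, hvd⟩ := hcov i hi
    exact ⟨v, hv, z, hdiam i.2 v hvd z hz, hzc⟩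

end Tube

end Summit.QuantumFields.BalabanUV.Gaps.D4WalkBlockDecorateChains

end
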